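import Summits.CriticalPhenomena.SAWScalingLimit.Theorems.SAWDefectDecoherenceBoundaryClosureRSidePhaseCornerFlat
import Summits.CriticalPhenomena.SAWScalingLimit.Theorems.SAWDefectDecoherenceBoundaryClosureRSidePhaseCornerStepsTwo
import Summits.CriticalPhenomena.SAWScalingLimit.Theorems.SAWDefectDecoherenceBoundaryClosureRSidePhaseCornerGeometry
import HarnessLib

/-!
# Crux `BoundaryClosureR` (stmt-CriticalPhenomena-14004), line `polygon-parity-squeeze`:
# the corner phase relation at the lattice corners of forms `0` and `2`
# (base case of `sidePhase_corner`, sub-goal (A1b') of `stub_polygonIdentification`)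

Companion of `…SidePhaseCornerBaseThree` for the second base pair of forms.  Let the simply
connected `Λ`, rooted at the boundary dart `{u, w}`, be inside `ball x r` an exact lattice corner
of the floor half-lattice `{n ≤ zigzagForm 0}` and the half-lattice `{n' ≤ zigzagForm 2}`
(intersection = convex `60°` corner, union = reflex `300°` corner), whose corner face lies in
`ball x (r - 7)`, the root midpoint being outside `ball x r`.  Then for a floor dart `e` (heading
`-90°`) and a column dart `e'` (heading `150°`) with midpoints in `ball x (r - 4)`:

* `chain_two` (winding level): every walk from the root to `e` is matched by a walk to `e'` whose
  winding is smaller by `2π/3` (`floor_transfer`, `step_two_convex` / `step_two_reflex` with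
  winding rigidity, `side2_transfer`);
* `sidePhaseCorner_base_two` (observable level):
  `F(e')·|F₀(e)| = e^{-i(5/8)·arg(n₂/n₀)} F(e)·|F₀(e')|` (`arg(n₂/n₀) = -2π/3`).

Sources: H. Duminil-Copin, S. Smirnov, Ann. of Math. 175 (2012), §3 (the winding of walks to the
boundary is rigid).  No definition is introduced.
-/

noncomputable section

open scoped BigOperators Topology
open Filter Set Metric Complex
open Literature.Probability.LatticeModels Literature.Probability.RandomPlanarGeometry
open Literature.Probability.RandomPlanarGeometry.SAW
open Summit.CriticalPhenomena.SAWScalingLimit.Theorems.PickHalfPlane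

namespace Summit.CriticalPhenomena.SAWScalingLimit.Theorems.PolygonParitySqueeze

namespace SidePhaseCorner

variable {Λ : Finset HexVertex}

/-! ### 1. The values of the two forms on explicit faces -/

/-- `zigzagForm 0` and `zigzagForm 2` on an explicit face `(i,l,t)`: `l` and `i`. [folklore] -/
theorem zigzagForm_zero_two (i l : ℤ) (t : Fin 2) :
    zigzagForm 0 ((![i, l], t) : HexVertex) = l ∧ zigzagForm 2 ((![i, l], t) : HexVertex) = i := by
  simp [zigzagForm]

/-! ### 2. The winding chain at a convex corner of forms `0`, `2` -/

/-- **The winding across a convex corner of forms `0`, `2` (`60°`).** Inside `ball x r` let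
`Λ = {n ≤ zigzagForm 0} ∩ {n' ≤ zigzagForm 2}` with the corner face in `ball x (r - 7)` and the
root midpoint outside `ball x r`; let `e = {(j,m-1,1) ∉ Λ, (j,m,0) ∈ Λ}` be a floor dart and
`e' = {(c-1,y,1) ∉ Λ, (c,y,0) ∈ Λ}` a column dart with midpoints in `ball x (r - 4)`.  Every walk from
the root to `e` is matched by a walk to `e'` with winding smaller by `2π/3`.
[cite: DuminilCopinSmirnov2012, §3 (winding of walks to the boundary)] -/
theorem chain_two_convex (hΛ : hexDomainSimplyConnected Λ) {u w : HexVertex}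
    (huw : hexGraph.Adj u w) (hu : u ∉ Λ) (hw : w ∈ Λ) {n n' : ℤ} {x : ℂ} {r : ℝ}
    (hpin : ∀ v : HexVertex, hexCenter v ∈ Metric.ball x r →
      (v ∈ Λ ↔ (n ≤ zigzagForm 0 v ∧ n' ≤ zigzagForm 2 v)))
    (hapex : ∃ v₀ : HexVertex, hexCenter v₀ ∈ Metric.ball x (r - 7) ∧ zigzagForm 0 v₀ = n ∧
      zigzagForm 2 v₀ = n')
    (hroot : hexMidpoint s(u, w) ∉ Metric.ball x r) {j m c y : ℤ}
    (hv : ((![j, m], 0) : HexVertex) ∈ Λ) (ht : ((![j, m - 1], 1) : HexVertex) ∉ Λ)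
    (he : hexMidpoint s(((![j, m - 1], 1) : HexVertex), ((![j, m], 0) : HexVertex)) ∈
      Metric.ball x (r - 4))
    (hv' : ((![c, y], 0) : HexVertex) ∈ Λ) (ht' : ((![c - 1, y], 1) : HexVertex) ∉ Λ)
    (he' : hexMidpoint s(((![c - 1, y], 1) : HexVertex), ((![c, y], 0) : HexVertex)) ∈
      Metric.ball x (r - 4))
    (γ : HexMidEdgeSAW Λ s(u, w) s(((![j, m - 1], 1) : HexVertex), ((![j, m], 0) : HexVertex))) :
    ∃ γ' : HexMidEdgeSAW Λ s(u, w) s(((![c - 1, y], 1) : HexVertex), ((![c, y], 0) : HexVertex)),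
      γ'.winding = γ.winding - 2 * Real.pi / 3 := by
  have aS2 : ∀ k l : ℤ, hexGraph.Adj ((![k - 1, l], 1) : HexVertex) (![k, l], 0) := fun k l => by
    rw [hexGraph_adj_iff_coord]; simp
  -- the threshold rows of the two given darts: `m = n`, `c ≤ j`, `c = n'`, `m ≤ y`
  obtain ⟨bv, bt, -⟩ := near_floor he
  obtain ⟨bv', bt', -⟩ := near_side2 he'
  have fv := (hpin _ bv).1 hv
  have ft : ¬(n ≤ zigzagForm 0 ((![j, m - 1], 1) : HexVertex) ∧ n' ≤ zigzagForm 2 ((![j, m - 1], 1) : HexVertex)) :=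
    fun h => ht ((hpin _ bt).2 h)
  have fv' := (hpin _ bv').1 hv'
  have ft' : ¬(n ≤ zigzagForm 0 ((![c - 1, y], 1) : HexVertex) ∧ n' ≤ zigzagForm 2 ((![c - 1, y], 1) : HexVertex)) :=
    fun h => ht' ((hpin _ bt').2 h)
  simp only [zigzagForm_zero_two] at fv ft fv' ft'
  obtain rfl : m = n := by omega
  obtain rfl : c = n' := by omega
  have hjc : c ≤ j := by omega
  have hny : m ≤ y := by omega
  -- the corner face and the two corner darts (both hang from the tip `(c,m,0)`)
  obtain ⟨⟨x₀, t₀⟩, hv₀, f0, f2⟩ := hapex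
  have hx₀ : x₀ = ![c, m] := by
    rw [site_two_eq_iff]
    simp [zigzagForm] at f0 f2
    simp only [Matrix.cons_val_zero, Matrix.cons_val_one]
    constructor <;> omega
  subst hx₀
  have hv₀U : dist (hexCenter ((![c, m], t₀) : HexVertex)) (hexCenter ((![c, m], 0) : HexVertex)) ≤ 3 / 5 := by
    fin_cases t₀
    · simp only [Fin.zero_eta, Fin.isValue, dist_self]; norm_num
    · exact dist_hexCenter_le_of_adj (hexGraph_adj_up _ _).symm
  have heU : hexMidpoint s(((![c, m - 1], 1) : HexVertex), ((![c, m], 0) : HexVertex)) ∈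
      Metric.ball x (r - 4) := by
    refine mem_ball_of_dist_le (s := 3) (by convert hv₀ using 2; ring) ?_
    rw [dist_comm]
    linarith [dist_triangle (hexCenter ((![c, m], t₀) : HexVertex)) (hexCenter ((![c, m], 0) : HexVertex))
      (hexMidpoint s(((![c, m - 1], 1) : HexVertex), ((![c, m], 0) : HexVertex))),
      dist_hexCenter_hexMidpoint_mk_le (hexGraph_adj_dn c m).symm (Or.inr rfl)]
  have heM : hexMidpoint s(((![c - 1, m], 1) : HexVertex), ((![c, m], 0) : HexVertex)) ∈
      Metric.ball x (r - 4) := by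
    refine mem_ball_of_dist_le (s := 3) (by convert hv₀ using 2; ring) ?_
    rw [dist_comm]
    linarith [dist_triangle (hexCenter ((![c, m], t₀) : HexVertex)) (hexCenter ((![c, m], 0) : HexVertex))
      (hexMidpoint s(((![c - 1, m], 1) : HexVertex), ((![c, m], 0) : HexVertex))),
      dist_hexCenter_hexMidpoint_mk_le (aS2 c m) (Or.inr rfl)]
  -- the floor segment `c … j` and the column segment `m … y`: midpoints, faces, no root
  have midF : ∀ k : ℤ, c ≤ k → k ≤ j →
      hexMidpoint s(((![k, m - 1], 1) : HexVertex), ((![k, m], 0) : HexVertex)) ∈ Metric.ball x (r - 4) := by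
    intro k hk₁ hk₂
    rw [hexMidpoint_floor_eq] at he heU ⊢
    exact mem_ball_of_between heU he hk₁ hk₂
  have midS : ∀ l : ℤ, m ≤ l → l ≤ y →
      hexMidpoint s(((![c - 1, l], 1) : HexVertex), ((![c, l], 0) : HexVertex)) ∈ Metric.ball x (r - 4) := by
    intro l hl₁ hl₂
    rw [hexMidpoint_side2_eq] at he' heM ⊢
    exact mem_ball_of_between heM he' hl₁ hl₂
  have hF : ∀ k : ℤ, c ≤ k → k ≤ j → ((![k, m], 0) : HexVertex) ∈ Λ ∧
      ((![k, m - 1], 1) : HexVertex) ∉ Λ ∧ (k < j → ((![k, m], 1) : HexVertex) ∈ Λ) := by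
    intro k hk₁ hk₂
    obtain ⟨b0, b1, b2⟩ := near_floor (midF k hk₁ hk₂)
    refine ⟨(hpin _ b0).2 ?_, fun h => ?_, fun _ => (hpin _ b2).2 ?_⟩
    · simp only [zigzagForm_zero_two]; omega
    · have h' := (hpin _ b1).1 h
      simp only [zigzagForm_zero_two] at h'; omega
    · simp only [zigzagForm_zero_two]; omega
  have hS : ∀ l : ℤ, m ≤ l → l ≤ y → ((![c, l], 0) : HexVertex) ∈ Λ ∧
      ((![c - 1, l], 1) : HexVertex) ∉ Λ ∧ (l < y → ((![c, l], 1) : HexVertex) ∈ Λ) := by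
    intro l hl₁ hl₂
    obtain ⟨b0, b1, b2⟩ := near_side2 (midS l hl₁ hl₂)
    refine ⟨(hpin _ b0).2 ?_, fun h => ?_, fun _ => (hpin _ b2).2 ?_⟩
    · simp only [zigzagForm_zero_two]; omega
    · have h' := (hpin _ b1).1 h
      simp only [zigzagForm_zero_two] at h'; omega
    · simp only [zigzagForm_zero_two]; omega
  have rootF : ∀ k : ℤ, c ≤ k → k ≤ j →
      s(((![k, m - 1], 1) : HexVertex), ((![k, m], 0) : HexVertex)) ≠ s(u, w) := by
    intro k hk₁ hk₂ h
    exact hroot (h ▸ Metric.ball_subset_ball (by linarith) (midF k hk₁ hk₂))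
  have rootS : ∀ l : ℤ, m ≤ l → l ≤ y →
      s(((![c - 1, l], 1) : HexVertex), ((![c, l], 0) : HexVertex)) ≠ s(u, w) := by
    intro l hl₁ hl₂ h
    exact hroot (h ▸ Metric.ball_subset_ball (by linarith) (midS l hl₁ hl₂))
  -- the chain: floor transfer, corner step (with rigidity), column transfer
  obtain ⟨δ, hδ⟩ := floor_transfer hΛ huw hu hw hF rootF hjc le_rfl le_rfl hjc γ
  have hne : δ.verts ≠ [] := fun h => (rootF c le_rfl hjc) (δ.eq_of_nil h).symm
  have hvis : ∃ v ∈ δ.verts, v ∈ [((![c, m], 0) : HexVertex)] := by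
    refine ⟨_, List.getLast_mem hne, ?_⟩
    rcases δ.getLast_eq_or hne with h | h
    · exact absurd (h ▸ δ.subset _ (List.getLast_mem hne)) (hF c le_rfl hjc).2.1
    · rw [h]; simp
  obtain ⟨γ₀, γ₁, h01⟩ := step_two_convex hu huw (hF c le_rfl hjc).1 (hF c le_rfl hjc).2.1
    (hS m le_rfl hny).2.1 (rootF c le_rfl hjc).symm (rootS m le_rfl hny).symm δ hvis
  have hrig : δ.winding = γ₀.winding :=
    boundaryWindingRigidity_proof Λ hΛ _ (BoundaryExactness.mk_mem_hexDomainBoundary huw hu hw) _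
      (BoundaryExactness.mk_mem_hexDomainBoundary (hexGraph_adj_dn c m).symm (hF c le_rfl hjc).2.1
        (hF c le_rfl hjc).1) δ γ₀
  obtain ⟨γ', hγ'⟩ := side2_transfer hΛ huw hu hw hS rootS le_rfl hny hny le_rfl γ₁
  exact ⟨γ', by rw [hγ', h01, ← hrig, hδ]⟩

/-! ### 3. The winding chain at a reflex corner of forms `0`, `2` -/

/-- **The winding across a reflex corner of forms `0`, `2` (`300°`).** Inside `ball x r` let
`Λ = {n ≤ zigzagForm 0} ∪ {n' ≤ zigzagForm 2}` with the corner face in `ball x (r - 7)` and the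
root midpoint outside `ball x r`; let `e = {(j,m-1,1) ∉ Λ, (j,m,0) ∈ Λ}` be a floor dart and
`e' = {(c-1,y,1) ∉ Λ, (c,y,0) ∈ Λ}` a column dart with midpoints in `ball x (r - 4)`.  Every walk from
the root to `e` is matched by a walk to `e'` with winding smaller by `2π/3`.
[cite: DuminilCopinSmirnov2012, §3 (winding of walks to the boundary)] -/
theorem chain_two_reflex (hΛ : hexDomainSimplyConnected Λ) {u w : HexVertex}
    (huw : hexGraph.Adj u w) (hu : u ∉ Λ) (hw : w ∈ Λ) {n n' : ℤ} {x : ℂ} {r : ℝ}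
    (hpin : ∀ v : HexVertex, hexCenter v ∈ Metric.ball x r →
      (v ∈ Λ ↔ (n ≤ zigzagForm 0 v ∨ n' ≤ zigzagForm 2 v)))
    (hapex : ∃ v₀ : HexVertex, hexCenter v₀ ∈ Metric.ball x (r - 7) ∧ zigzagForm 0 v₀ = n ∧
      zigzagForm 2 v₀ = n')
    (hroot : hexMidpoint s(u, w) ∉ Metric.ball x r) {j m c y : ℤ}
    (hv : ((![j, m], 0) : HexVertex) ∈ Λ) (ht : ((![j, m - 1], 1) : HexVertex) ∉ Λ)
    (he : hexMidpoint s(((![j, m - 1], 1) : HexVertex), ((![j, m], 0) : HexVertex)) ∈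
      Metric.ball x (r - 4))
    (hv' : ((![c, y], 0) : HexVertex) ∈ Λ) (ht' : ((![c - 1, y], 1) : HexVertex) ∉ Λ)
    (he' : hexMidpoint s(((![c - 1, y], 1) : HexVertex), ((![c, y], 0) : HexVertex)) ∈
      Metric.ball x (r - 4))
    (γ : HexMidEdgeSAW Λ s(u, w) s(((![j, m - 1], 1) : HexVertex), ((![j, m], 0) : HexVertex))) :
    ∃ γ' : HexMidEdgeSAW Λ s(u, w) s(((![c - 1, y], 1) : HexVertex), ((![c, y], 0) : HexVertex)),
      γ'.winding = γ.winding - 2 * Real.pi / 3 := by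
  have aS2 : ∀ k l : ℤ, hexGraph.Adj ((![k - 1, l], 1) : HexVertex) (![k, l], 0) := fun k l => by
    rw [hexGraph_adj_iff_coord]; simp
  -- the threshold rows of the two given darts: `m = n`, `j ≤ c - 1`, `c = n'`, `y ≤ m - 1`
  obtain ⟨bv, bt, -⟩ := near_floor he
  obtain ⟨bv', bt', -⟩ := near_side2 he'
  have fv := (hpin _ bv).1 hv
  have ft : ¬(n ≤ zigzagForm 0 ((![j, m - 1], 1) : HexVertex) ∨ n' ≤ zigzagForm 2 ((![j, m - 1], 1) : HexVertex)) :=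
    fun h => ht ((hpin _ bt).2 h)
  have fv' := (hpin _ bv').1 hv'
  have ft' : ¬(n ≤ zigzagForm 0 ((![c - 1, y], 1) : HexVertex) ∨ n' ≤ zigzagForm 2 ((![c - 1, y], 1) : HexVertex)) :=
    fun h => ht' ((hpin _ bt').2 h)
  simp only [zigzagForm_zero_two] at fv ft fv' ft'
  obtain rfl : m = n := by omega
  obtain rfl : c = n' := by omega
  have hjc : j ≤ c - 1 := by omega
  have hny : y ≤ m - 1 := by omega
  -- the corner face and the two corner darts (both hang into the exterior tip `(c-1,m-1,1)`)
  obtain ⟨⟨x₀, t₀⟩, hv₀, f0, f2⟩ := hapex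
  have hx₀ : x₀ = ![c, m] := by
    rw [site_two_eq_iff]
    simp [zigzagForm] at f0 f2
    simp only [Matrix.cons_val_zero, Matrix.cons_val_one]
    constructor <;> omega
  subst hx₀
  have hv₀Q : dist (hexCenter ((![c, m], t₀) : HexVertex)) (hexCenter ((![c, m], 0) : HexVertex)) ≤ 3 / 5 := by
    fin_cases t₀
    · simp only [Fin.zero_eta, Fin.isValue, dist_self]; norm_num
    · exact dist_hexCenter_le_of_adj (hexGraph_adj_up _ _).symm
  have heU : hexMidpoint s(((![c - 1, m - 1], 1) : HexVertex), ((![c - 1, m], 0) : HexVertex)) ∈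
      Metric.ball x (r - 4) := by
    refine mem_ball_of_dist_le (s := 3) (by convert hv₀ using 2; ring) ?_
    rw [dist_comm]
    linarith [dist_triangle4 (hexCenter ((![c, m], t₀) : HexVertex)) (hexCenter ((![c, m], 0) : HexVertex))
      (hexCenter ((![c - 1, m], 1) : HexVertex))
      (hexMidpoint s(((![c - 1, m - 1], 1) : HexVertex), ((![c - 1, m], 0) : HexVertex))),
      dist_triangle (hexCenter ((![c - 1, m], 1) : HexVertex)) (hexCenter ((![c - 1, m], 0) : HexVertex))
      (hexMidpoint s(((![c - 1, m - 1], 1) : HexVertex), ((![c - 1, m], 0) : HexVertex))),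
      dist_hexCenter_hexMidpoint_mk_le (hexGraph_adj_dn (c - 1) m).symm (Or.inr rfl),
      dist_hexCenter_le_of_adj (aS2 c m).symm, dist_hexCenter_le_of_adj (hexGraph_adj_up (c - 1) m).symm]
  have heM : hexMidpoint s(((![c - 1, m - 1], 1) : HexVertex), ((![c, m - 1], 0) : HexVertex)) ∈
      Metric.ball x (r - 4) := by
    refine mem_ball_of_dist_le (s := 3) (by convert hv₀ using 2; ring) ?_
    rw [dist_comm]
    linarith [dist_triangle4 (hexCenter ((![c, m], t₀) : HexVertex)) (hexCenter ((![c, m], 0) : HexVertex))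
      (hexCenter ((![c, m - 1], 1) : HexVertex))
      (hexMidpoint s(((![c - 1, m - 1], 1) : HexVertex), ((![c, m - 1], 0) : HexVertex))),
      dist_triangle (hexCenter ((![c, m - 1], 1) : HexVertex)) (hexCenter ((![c, m - 1], 0) : HexVertex))
      (hexMidpoint s(((![c - 1, m - 1], 1) : HexVertex), ((![c, m - 1], 0) : HexVertex))),
      dist_hexCenter_hexMidpoint_mk_le (aS2 c (m - 1)) (Or.inr rfl),
      dist_hexCenter_le_of_adj (hexGraph_adj_dn c m).symm.symm, dist_hexCenter_le_of_adj (hexGraph_adj_up c (m - 1)).symm]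
  -- the floor segment `j … c - 1` and the column segment `y … m - 1`: midpoints, faces, no root
  have midF : ∀ k : ℤ, j ≤ k → k ≤ c - 1 →
      hexMidpoint s(((![k, m - 1], 1) : HexVertex), ((![k, m], 0) : HexVertex)) ∈ Metric.ball x (r - 4) := by
    intro k hk₁ hk₂
    rw [hexMidpoint_floor_eq] at he heU ⊢
    exact mem_ball_of_between he heU hk₁ hk₂
  have midS : ∀ l : ℤ, y ≤ l → l ≤ m - 1 →
      hexMidpoint s(((![c - 1, l], 1) : HexVertex), ((![c, l], 0) : HexVertex)) ∈ Metric.ball x (r - 4) := by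
    intro l hl₁ hl₂
    rw [hexMidpoint_side2_eq] at he' heM ⊢
    exact mem_ball_of_between he' heM hl₁ hl₂
  have hF : ∀ k : ℤ, j ≤ k → k ≤ c - 1 → ((![k, m], 0) : HexVertex) ∈ Λ ∧
      ((![k, m - 1], 1) : HexVertex) ∉ Λ ∧ (k < c - 1 → ((![k, m], 1) : HexVertex) ∈ Λ) := by
    intro k hk₁ hk₂
    obtain ⟨b0, b1, b2⟩ := near_floor (midF k hk₁ hk₂)
    refine ⟨(hpin _ b0).2 ?_, fun h => ?_, fun _ => (hpin _ b2).2 ?_⟩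
    · simp only [zigzagForm_zero_two]; omega
    · have h' := (hpin _ b1).1 h
      simp only [zigzagForm_zero_two] at h'; omega
    · simp only [zigzagForm_zero_two]; omega
  have hS : ∀ l : ℤ, y ≤ l → l ≤ m - 1 → ((![c, l], 0) : HexVertex) ∈ Λ ∧
      ((![c - 1, l], 1) : HexVertex) ∉ Λ ∧ (l < m - 1 → ((![c, l], 1) : HexVertex) ∈ Λ) := by
    intro l hl₁ hl₂
    obtain ⟨b0, b1, b2⟩ := near_side2 (midS l hl₁ hl₂)
    refine ⟨(hpin _ b0).2 ?_, fun h => ?_, fun _ => (hpin _ b2).2 ?_⟩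
    · simp only [zigzagForm_zero_two]; omega
    · have h' := (hpin _ b1).1 h
      simp only [zigzagForm_zero_two] at h'; omega
    · simp only [zigzagForm_zero_two]; omega
  have rootF : ∀ k : ℤ, j ≤ k → k ≤ c - 1 →
      s(((![k, m - 1], 1) : HexVertex), ((![k, m], 0) : HexVertex)) ≠ s(u, w) := by
    intro k hk₁ hk₂ h
    exact hroot (h ▸ Metric.ball_subset_ball (by linarith) (midF k hk₁ hk₂))
  have rootS : ∀ l : ℤ, y ≤ l → l ≤ m - 1 →
      s(((![c - 1, l], 1) : HexVertex), ((![c, l], 0) : HexVertex)) ≠ s(u, w) := by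
    intro l hl₁ hl₂ h
    exact hroot (h ▸ Metric.ball_subset_ball (by linarith) (midS l hl₁ hl₂))
  -- the three interior faces of the window lie in the ball, hence in `Λ`
  have hQ₁ : ((![c - 1, m], 1) : HexVertex) ∈ Λ := by
    refine (hpin _ (mem_ball_of_dist_le (s := 4) (midF (c - 1) hjc le_rfl) ?_)).2
      (by simp only [zigzagForm_zero_two]; omega)
    linarith [dist_triangle (hexCenter ((![c - 1, m], 1) : HexVertex)) (hexCenter ((![c - 1, m], 0) : HexVertex))
      (hexMidpoint s(((![c - 1, m - 1], 1) : HexVertex), ((![c - 1, m], 0) : HexVertex))),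
      dist_hexCenter_hexMidpoint_mk_le (hexGraph_adj_dn (c - 1) m).symm (Or.inr rfl),
      dist_hexCenter_le_of_adj (hexGraph_adj_up (c - 1) m).symm]
  have hQ₂ : ((![c, m], 0) : HexVertex) ∈ Λ := by
    refine (hpin _ (mem_ball_of_dist_le (s := 4) (midF (c - 1) hjc le_rfl) ?_)).2
      (by simp only [zigzagForm_zero_two]; omega)
    linarith [dist_triangle4 (hexCenter ((![c, m], 0) : HexVertex)) (hexCenter ((![c - 1, m], 1) : HexVertex))
      (hexCenter ((![c - 1, m], 0) : HexVertex))
      (hexMidpoint s(((![c - 1, m - 1], 1) : HexVertex), ((![c - 1, m], 0) : HexVertex))),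
      dist_hexCenter_hexMidpoint_mk_le (hexGraph_adj_dn (c - 1) m).symm (Or.inr rfl),
      dist_hexCenter_le_of_adj (aS2 c m).symm, dist_hexCenter_le_of_adj (hexGraph_adj_up (c - 1) m).symm]
  have hQ₃ : ((![c, m - 1], 1) : HexVertex) ∈ Λ := by
    refine (hpin _ (mem_ball_of_dist_le (s := 4) (midS (m - 1) hny le_rfl) ?_)).2
      (by simp only [zigzagForm_zero_two]; omega)
    linarith [dist_triangle (hexCenter ((![c, m - 1], 1) : HexVertex)) (hexCenter ((![c, m - 1], 0) : HexVertex))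
      (hexMidpoint s(((![c - 1, m - 1], 1) : HexVertex), ((![c, m - 1], 0) : HexVertex))),
      dist_hexCenter_hexMidpoint_mk_le (aS2 c (m - 1)) (Or.inr rfl),
      dist_hexCenter_le_of_adj (hexGraph_adj_up c (m - 1)).symm]
  -- the chain: floor transfer, corner step (with rigidity), column transfer
  obtain ⟨δ, hδ⟩ := floor_transfer hΛ huw hu hw hF rootF le_rfl hjc hjc le_rfl γ
  have hne : δ.verts ≠ [] := fun h => (rootF (c - 1) hjc le_rfl) (δ.eq_of_nil h).symm
  have hvis : ∃ v ∈ δ.verts, v ∈ [((![c - 1, m], 0) : HexVertex), (![c - 1, m], 1), (![c, m], 0),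
      (![c, m - 1], 1), (![c, m - 1], 0)] := by
    refine ⟨_, List.getLast_mem hne, ?_⟩
    rcases δ.getLast_eq_or hne with h | h
    · exact absurd (h ▸ δ.subset _ (List.getLast_mem hne)) (hF (c - 1) hjc le_rfl).2.1
    · rw [h]; simp
  obtain ⟨γ₀, γ₁, h01⟩ := step_two_reflex hu huw (hF (c - 1) hjc le_rfl).1 hQ₁ hQ₂ hQ₃
    (hS (m - 1) hny le_rfl).1 (hF (c - 1) hjc le_rfl).2.1 (rootF (c - 1) hjc le_rfl).symm
    (rootS (m - 1) hny le_rfl).symm δ hvis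
  have hrig : δ.winding = γ₀.winding :=
    boundaryWindingRigidity_proof Λ hΛ _ (BoundaryExactness.mk_mem_hexDomainBoundary huw hu hw) _
      (BoundaryExactness.mk_mem_hexDomainBoundary (hexGraph_adj_dn (c - 1) m).symm (hF (c - 1) hjc le_rfl).2.1
        (hF (c - 1) hjc le_rfl).1) δ γ₀
  obtain ⟨γ', hγ'⟩ := side2_transfer hΛ huw hu hw hS rootS hny le_rfl le_rfl hny γ₁
  exact ⟨γ', by rw [hγ', h01, ← hrig, hδ]⟩

/-! ### 4. The corner phase relation for the forms `0`, `2` -/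

/-- The two chains, convex or reflex. [cite: DuminilCopinSmirnov2012, §3 (winding of walks to the boundary)] -/
theorem chain_two (hΛ : hexDomainSimplyConnected Λ) {u w : HexVertex}
    (huw : hexGraph.Adj u w) (hu : u ∉ Λ) (hw : w ∈ Λ) {n n' : ℤ} {x : ℂ} {r : ℝ}
    (hpin : (∀ v : HexVertex, hexCenter v ∈ Metric.ball x r →
      (v ∈ Λ ↔ (n ≤ zigzagForm 0 v ∧ n' ≤ zigzagForm 2 v))) ∨ (∀ v : HexVertex,
      hexCenter v ∈ Metric.ball x r → (v ∈ Λ ↔ (n ≤ zigzagForm 0 v ∨ n' ≤ zigzagForm 2 v))))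
    (hapex : ∃ v₀ : HexVertex, hexCenter v₀ ∈ Metric.ball x (r - 7) ∧ zigzagForm 0 v₀ = n ∧
      zigzagForm 2 v₀ = n')
    (hroot : hexMidpoint s(u, w) ∉ Metric.ball x r) {j m c y : ℤ}
    (hv : ((![j, m], 0) : HexVertex) ∈ Λ) (ht : ((![j, m - 1], 1) : HexVertex) ∉ Λ)
    (he : hexMidpoint s(((![j, m - 1], 1) : HexVertex), ((![j, m], 0) : HexVertex)) ∈
      Metric.ball x (r - 4))
    (hv' : ((![c, y], 0) : HexVertex) ∈ Λ) (ht' : ((![c - 1, y], 1) : HexVertex) ∉ Λ)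
    (he' : hexMidpoint s(((![c - 1, y], 1) : HexVertex), ((![c, y], 0) : HexVertex)) ∈
      Metric.ball x (r - 4))
    (γ : HexMidEdgeSAW Λ s(u, w) s(((![j, m - 1], 1) : HexVertex), ((![j, m], 0) : HexVertex))) :
    ∃ γ' : HexMidEdgeSAW Λ s(u, w) s(((![c - 1, y], 1) : HexVertex), ((![c, y], 0) : HexVertex)),
      γ'.winding = γ.winding - 2 * Real.pi / 3 := by
  rcases hpin with hpin | hpin
  · exact chain_two_convex hΛ huw hu hw hpin hapex hroot hv ht he hv' ht' he' γ
  · exact chain_two_reflex hΛ huw hu hw hpin hapex hroot hv ht he hv' ht' he' γ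

end SidePhaseCorner

/-- **The corner phase relation at a lattice corner of forms `0`, `2` (base case of
`sidePhase_corner`).** For a simply connected `Λ` rooted at the boundary dart `{u, w}`, which
inside `ball x r` is the exact convex (`∧`) or reflex (`∨`) corner of the half-lattices
`{n ≤ zigzagForm 0}`, `{n' ≤ zigzagForm 2}` with the corner face in `ball x (r - 7)` and the root
midpoint outside `ball x r`, a floor dart `e = {v, t}` (heading `-(1/√3) n₀`) and a column dart
`e' = {v', t'}` (heading `-(1/√3) n₂`) with midpoints in `ball x (r - 4)` satisfy
`F(e')·|F₀(e)| = e^{-i(5/8)·arg(n₂/n₀)} F(e)·|F₀(e')|` (phase factorisation at boundary darts and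
`chain_two`; no walk to `e`: both sides vanish).
[cite: DuminilCopinSmirnov2012, §3 (winding of walks to the boundary)] -/
theorem sidePhaseCorner_base_two : ∀ (Λ : Finset HexVertex), hexDomainSimplyConnected Λ → ∀ (u w : HexVertex), hexGraph.Adj u w → u ∉ Λ → w ∈ Λ → ∀ (n n' : ℤ) (x : ℂ) (r : ℝ), innerNormal 2 ≠ innerNormal 0 → innerNormal 2 ≠ -innerNormal 0 → ((∀ v : HexVertex, hexCenter v ∈ Metric.ball x r → (v ∈ Λ ↔ (n ≤ zigzagForm 0 v ∧ n' ≤ zigzagForm 2 v))) ∨ (∀ v : HexVertex, hexCenter v ∈ Metric.ball x r → (v ∈ Λ ↔ (n ≤ zigzagForm 0 v ∨ n' ≤ zigzagForm 2 v)))) → (∃ v₀ : HexVertex, hexCenter v₀ ∈ Metric.ball x (r - 7) ∧ zigzagForm 0 v₀ = n ∧ zigzagForm 2 v₀ = n') → hexMidpoint s(u, w) ∉ Metric.ball x r → ∀ (v t v' t' : HexVertex), v ∈ Λ → t ∉ Λ → hexGraph.Adj v t → v' ∈ Λ → t' ∉ Λ → hexGraph.Adj v' t' → hexCenter t - hexCenter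 v = -((1 / Real.sqrt 3 : ℝ) : ℂ) * innerNormal 0 → hexCenter t' - hexCenter v' = -((1 / Real.sqrt 3 : ℝ) : ℂ) * innerNormal 2 → hexMidpoint s(v, t) ∈ Metric.ball x (r - 4) → hexMidpoint s(v', t') ∈ Metric.ball x (r - 4) → hexParafermionicObservable Λ s(u, w) hexCriticalFugacity (5 / 8) s(v', t') * ((‖hexParafermionicObservable Λ s(u, w) hexCriticalFugacity 0 s(v, t)‖ : ℝ) : ℂ) = Complex.exp (-(5 / 8 : ℂ) * (Complex.arg (innerNormal 2 / innerNormal 0) : ℂ) * Complex.I) * hexParafermionicObservable Λ s(u, w) hexCriticalFugacity (5 / 8) s(v, t) * ((‖hexParafermionicObservable Λ s(u, w) hexCriticalFugacity 0 s(v', t')‖ : ℝ) : ℂ) := by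
  intro Λ hΛ u w huw hu hw n n' x r _ _ hpin hapex hroot v t v' t' hv ht hvt hv' ht' hvt' hdir hdir'
    heb heb'
  obtain ⟨j, m, rfl, rfl⟩ := SidePhaseCorner.dart_coord_zero hvt hdir
  obtain ⟨c, y, rfl, rfl⟩ := SidePhaseCorner.dart_coord_two hvt' hdir'
  rw [Sym2.eq_swap (a := ((![j, m], 0) : HexVertex)) (b := (![j, m - 1], 1))] at heb ⊢
  rw [Sym2.eq_swap (a := ((![c, y], 0) : HexVertex)) (b := (![c - 1, y], 1))] at heb' ⊢
  have ha : s(u, w) ∈ hexDomainBoundary Λ := BoundaryExactness.mk_mem_hexDomainBoundary huw hu hw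
  have hb : s(((![j, m - 1], 1) : HexVertex), ((![j, m], 0) : HexVertex)) ∈ hexDomainBoundary Λ :=
    BoundaryExactness.mk_mem_hexDomainBoundary hvt.symm ht hv
  have hb' : s(((![c - 1, y], 1) : HexVertex), ((![c, y], 0) : HexVertex)) ∈ hexDomainBoundary Λ :=
    BoundaryExactness.mk_mem_hexDomainBoundary hvt'.symm ht' hv'
  -- no walk to `e`: both sides vanish
  by_cases hne : Nonempty (HexMidEdgeSAW Λ s(u, w)
      s(((![j, m - 1], 1) : HexVertex), ((![j, m], 0) : HexVertex)))
  swap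
  · rw [not_nonempty_iff] at hne
    have h0 : ∀ σ : ℝ, hexParafermionicObservable Λ s(u, w) hexCriticalFugacity σ
        s(((![j, m - 1], 1) : HexVertex), ((![j, m], 0) : HexVertex)) = 0 := fun σ => by
      rw [hexParafermionicObservable_def, Finset.univ_eq_empty, Finset.sum_empty]
    rw [h0, h0, norm_zero, Complex.ofReal_zero, mul_zero, mul_zero, zero_mul]
  obtain ⟨γ⟩ := hne
  obtain ⟨γ', hγ'⟩ := SidePhaseCorner.chain_two hΛ huw hu hw hpin hapex hroot hv ht heb hv' ht' heb' γ
  rw [LocalL1.observable_eq_phase_mul_zero_spin_of_mem_boundary hΛ ha hb γ hexCriticalFugacity (5 / 8),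
    LocalL1.observable_eq_phase_mul_zero_spin_of_mem_boundary hΛ ha hb' γ' hexCriticalFugacity (5 / 8),
    hγ', SidePhaseCorner.arg_innerNormal_two_div_zero, GateMass.norm_obs_zero_eq_archMass,
    GateMass.norm_obs_zero_eq_archMass, hexParafermionicObservable_zero_spin,
    hexParafermionicObservable_zero_spin]
  have hexp : Complex.exp (-Complex.I * ((5 / 8 : ℝ) : ℂ) * ((γ.winding - 2 * Real.pi / 3 : ℝ) : ℂ)) =
      Complex.exp (-(5 / 8 : ℂ) * ((-(2 * Real.pi / 3) : ℝ) : ℂ) * Complex.I) *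
        Complex.exp (-Complex.I * ((5 / 8 : ℝ) : ℂ) * (γ.winding : ℂ)) := by
    rw [← Complex.exp_add]
    congr 1
    push_cast
    ring
  rw [hexp]
  ring

end Summit.CriticalPhenomena.SAWScalingLimit.Theorems.PolygonParitySqueeze

end
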